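import Literature.NumberTheory.LFunctions.SoundZeroTermIntegrals
import Literature.NumberTheory.LFunctions.SoundArchTermEvaluation
import Literature.NumberTheory.LFunctions.WeilExplicitContinuous
import Literature.NumberTheory.LFunctions.ZetaLogDerivReZeroSum
import Literature.NumberTheory.LFunctions.WeilZeroSum
import Literature.NumberTheory.LFunctions.ZetaZerosProofs
import HarnessLib

/-!
# Sums over the zeros for Balazard–de Roton's Prop. 5 (Weil route): symmetry and summability

Topic `Literature/NumberTheory/LFunctions`. Everything here is PROVED. Infrastructure for the
zero side `Σ_ρ m(ρ) ĝ_u(ρ)` of the explicit formula applied to `g_u = SoundTest.test c_u L`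
(M. Balazard, A. de Roton, arXiv:0810.3587, proof of Prop. 5, done through the Guinand–Weil
formula): the conjugation symmetry of the multiset of non-trivial zeros as an `Equiv` and the
resulting reindexing of `tsum`s, the consequences of RH (`Re ρ = ½`, `1 − ρ = ρ̄`), and the
summability over the zeros of `m(ρ)/‖s − ρ‖²`, of `m(ρ)(log‖s' − ρ‖ − log‖s − ρ‖)` and of the
paired Mellin transforms `m(ρ) ĝ_u(ρ)` uniformly in `u ∈ [σ, 2]`.

## References

* [BalazardDeRoton2008] M. Balazard, A. de Roton, arXiv:0810.3587, Prop. 5. [cite: BalazardDeRoton2008, Prop. 5 (proof)]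
-/

noncomputable section

open Complex Filter Set MeasureTheory Topology
open scoped Real ComplexConjugate

namespace Literature.NumberTheory.LFunctions

namespace SoundTest

/-- Short name for the subtype of non-trivial zeros. -/
local notation "𝒵" => ZetaZeros.riemannZetaNontrivialZeros

/-! ## Conjugation symmetry -/

/-- Conjugation as a permutation of the non-trivial zeros. [folklore] -/
def conjZero : 𝒵 → 𝒵 := fun ρ ↦ ⟨conj (ρ : ℂ), ZetaZeros.riemannZetaNontrivialZeros.conj_mem ρ.2⟩

/-- `conjZero` is an involution. [folklore] -/
theorem conjZero_involutive : Function.Involutive conjZero := fun ρ ↦ by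
  apply Subtype.ext
  simp [conjZero]

/-- The value of `conjZero`. [folklore] -/
@[simp] theorem coe_conjZero (ρ : 𝒵) : ((conjZero ρ : 𝒵) : ℂ) = conj (ρ : ℂ) := rfl

/-- **Reindexing by conjugation**: `Σ_ρ m(ρ) h(ρ̄) = Σ_ρ m(ρ) h(ρ)` (`m(ρ̄) = m(ρ)`,
`riemannZetaZeroOrder_conj_holds`). [folklore] -/
theorem tsum_zeroOrder_mul_conj {E : Type*} [NormedAddCommGroup E] [NormedSpace ℝ E] (h : ℂ → E) :
    ∑' ρ : 𝒵, (riemannZetaZeroOrder (ρ : ℂ) : ℝ) • h (conj (ρ : ℂ)) =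
      ∑' ρ : 𝒵, (riemannZetaZeroOrder (ρ : ℂ) : ℝ) • h ρ := by
  have e := Equiv.tsum_eq (conjZero_involutive.toPerm _) (fun ρ : 𝒵 ↦ (riemannZetaZeroOrder (ρ : ℂ) : ℝ) • h ρ)
  rw [← e]
  refine tsum_congr fun ρ ↦ ?_
  simp only [Function.Involutive.coe_toPerm, coe_conjZero]
  rw [riemannZetaZeroOrder_conj_holds]

/-- Real-valued version of the reindexing. [folklore] -/
theorem tsum_zeroOrder_mul_conj_real (h : ℂ → ℝ) :
    ∑' ρ : 𝒵, (riemannZetaZeroOrder (ρ : ℂ) : ℝ) * h (conj (ρ : ℂ)) =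
      ∑' ρ : 𝒵, (riemannZetaZeroOrder (ρ : ℂ) : ℝ) * h ρ := by
  have := tsum_zeroOrder_mul_conj (E := ℝ) h
  simpa only [smul_eq_mul] using this

/-- Summability transfers along conjugation. [folklore] -/
theorem summable_conj_iff {E : Type*} [NormedAddCommGroup E] [NormedSpace ℝ E] (h : ℂ → E) :
    (Summable fun ρ : 𝒵 ↦ (riemannZetaZeroOrder (ρ : ℂ) : ℝ) • h (conj (ρ : ℂ))) ↔
      Summable fun ρ : 𝒵 ↦ (riemannZetaZeroOrder (ρ : ℂ) : ℝ) • h ρ := by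
  have e := Equiv.summable_iff (conjZero_involutive.toPerm _)
    (f := fun ρ : 𝒵 ↦ (riemannZetaZeroOrder (ρ : ℂ) : ℝ) • h ρ)
  rw [← e]
  refine summable_congr fun ρ ↦ ?_
  simp only [Function.comp_apply, Function.Involutive.coe_toPerm, coe_conjZero]
  rw [riemannZetaZeroOrder_conj_holds]

/-! ## Consequences of RH -/

/-- Multiplicities of non-trivial zeros are non-negative (indeed `≥ 1`). [folklore] -/
theorem zeroOrder_nonneg (ρ : 𝒵) : 0 ≤ (riemannZetaZeroOrder (ρ : ℂ) : ℝ) := by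
  have h := ZetaZeros.riemannZetaNontrivialZeros.one_le_order ρ.2
  exact_mod_cast (le_trans zero_le_one h)

/-- Under RH every non-trivial zero has real part `½`. [folklore] -/
theorem re_eq_half_of_RH (hRH : RiemannHypothesis) (ρ : 𝒵) : (ρ : ℂ).re = 1 / 2 := by
  refine hRH ρ (ZetaZeros.riemannZetaNontrivialZeros.zeta_eq_zero ρ.2) ?_
    (ZetaZeros.riemannZetaNontrivialZeros.ne_one ρ.2)
  rintro ⟨n, hn⟩
  have h0 := ZetaZeros.riemannZetaNontrivialZeros.re_pos ρ.2
  rw [hn] at h0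
  simp at h0
  linarith

/-- Under RH, `1 − ρ = ρ̄`. [folklore] -/
theorem one_sub_eq_conj_of_RH (hRH : RiemannHypothesis) (ρ : 𝒵) : 1 - (ρ : ℂ) = conj (ρ : ℂ) := by
  apply Complex.ext
  · simp [re_eq_half_of_RH hRH ρ]; norm_num
  · simp

/-! ## Summability of `m(ρ)/‖s − ρ‖²` -/

/-- `1 + γ² ≤ 2 (1 + t²)(1 + (γ − t)²)`. [folklore] -/
theorem one_add_sq_le (γ t : ℝ) : 1 + γ ^ 2 ≤ 2 * (1 + t ^ 2) * (1 + (γ - t) ^ 2) := by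
  nlinarith [sq_nonneg (γ - 2 * t), sq_nonneg (t * (γ - t)), sq_nonneg ((γ - t) * t - 1),
    sq_nonneg (γ - t), sq_nonneg t, sq_nonneg (t * (γ - t) + 1)]

/-- Comparison of `1/((σ−½)² + (γ−t)²)` with `1/(1+γ²)`. [folklore] -/
theorem inv_dist_sq_le {σ t γ : ℝ} (hσ : 1 / 2 < σ) :
    1 / ((σ - 1 / 2) ^ 2 + (γ - t) ^ 2) ≤
      2 * (1 + t ^ 2) / min 1 ((σ - 1 / 2) ^ 2) * (1 / (1 + γ ^ 2)) := by
  set m₀ : ℝ := min 1 ((σ - 1 / 2) ^ 2) with hm₀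
  have hσ' : 0 < σ - 1 / 2 := by linarith
  have hm₀pos : 0 < m₀ := lt_min one_pos (by positivity)
  have hm₀1 : m₀ ≤ 1 := min_le_left _ _
  have hm₀2 : m₀ ≤ (σ - 1 / 2) ^ 2 := min_le_right _ _
  have hden : m₀ * (1 + (γ - t) ^ 2) ≤ (σ - 1 / 2) ^ 2 + (γ - t) ^ 2 := by
    nlinarith [sq_nonneg (γ - t)]
  have h1 := one_add_sq_le γ t
  have hpos : 0 < (σ - 1 / 2) ^ 2 + (γ - t) ^ 2 := by positivity
  rw [mul_one_div, div_div, div_le_div_iff₀ hpos (by positivity)]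
  have := mul_le_mul_of_nonneg_left hden (by positivity : 0 ≤ 1 + γ ^ 2)
  nlinarith [this, h1, hm₀pos]

/-- **`Σ_ρ m(ρ)/((σ−½)² + (γ − t)²) < ∞`** for `σ > ½` (no RH needed). [folklore] -/
theorem summable_zeroOrder_div_dist_sq {σ : ℝ} (hσ : 1 / 2 < σ) (t : ℝ) :
    Summable fun ρ : 𝒵 ↦ (riemannZetaZeroOrder (ρ : ℂ) : ℝ) / ((σ - 1 / 2) ^ 2 + ((ρ : ℂ).im - t) ^ 2) := by
  have hS := (ZetaZeroSum.summable_zeroOrder_div_one_add_sq).mul_left (2 * (1 + t ^ 2) / min 1 ((σ - 1 / 2) ^ 2))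
  refine Summable.of_nonneg_of_le (fun ρ ↦ div_nonneg (zeroOrder_nonneg ρ) (by positivity)) (fun ρ ↦ ?_) hS
  have h := inv_dist_sq_le (t := t) (γ := (ρ : ℂ).im) hσ
  have hm : 0 ≤ (riemannZetaZeroOrder (ρ : ℂ) : ℝ) := zeroOrder_nonneg ρ
  calc (riemannZetaZeroOrder (ρ : ℂ) : ℝ) / ((σ - 1 / 2) ^ 2 + ((ρ : ℂ).im - t) ^ 2)
      = (riemannZetaZeroOrder (ρ : ℂ) : ℝ) * (1 / ((σ - 1 / 2) ^ 2 + ((ρ : ℂ).im - t) ^ 2)) := by ring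
    _ ≤ (riemannZetaZeroOrder (ρ : ℂ) : ℝ) * (2 * (1 + t ^ 2) / min 1 ((σ - 1 / 2) ^ 2) * (1 / (1 + (ρ : ℂ).im ^ 2))) :=
        mul_le_mul_of_nonneg_left h hm
    _ = 2 * (1 + t ^ 2) / min 1 ((σ - 1 / 2) ^ 2) * ((riemannZetaZeroOrder (ρ : ℂ) : ℝ) / (1 + (ρ : ℂ).im ^ 2)) := by
        ring

/-- Under RH: `‖(σ+it) − ρ‖² = (σ−½)² + (γ−t)²`. [folklore] -/
theorem norm_sq_sub_zero_of_RH (hRH : RiemannHypothesis) (ρ : 𝒵) (σ t : ℝ) :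
    ‖((σ : ℂ) + t * I) - ρ‖ ^ 2 = (σ - 1 / 2) ^ 2 + ((ρ : ℂ).im - t) ^ 2 := by
  rw [Complex.sq_norm, Complex.normSq_apply]
  simp [re_eq_half_of_RH hRH ρ]
  ring

/-- Under RH: `Re 1/((σ+it) − ρ) = (σ−½)/‖(σ+it)−ρ‖²`. [folklore] -/
theorem re_inv_sub_zero_of_RH (hRH : RiemannHypothesis) (ρ : 𝒵) (σ t : ℝ) :
    (1 / (((σ : ℂ) + t * I) - ρ)).re = (σ - 1 / 2) / ((σ - 1 / 2) ^ 2 + ((ρ : ℂ).im - t) ^ 2) := by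
  rw [one_div, Complex.inv_re, ← Complex.sq_norm, norm_sq_sub_zero_of_RH hRH]
  simp [re_eq_half_of_RH hRH ρ]

/-- **`F(s) = (σ − ½) Σ_ρ m(ρ)/‖s−ρ‖²` under RH** (`s = σ + it`, `σ > ½`), with the sum
`Σ_ρ m(ρ)/‖s−ρ‖²` summable. [cite: BalazardDeRoton2008, Prop. 5 (proof)] -/
theorem reZeroSideSum_eq_of_RH (hRH : RiemannHypothesis) (σ t : ℝ) :
    reZeroSideSum ((σ : ℂ) + t * I) =
      (σ - 1 / 2) * ∑' ρ : 𝒵, (riemannZetaZeroOrder (ρ : ℂ) : ℝ) / ((σ - 1 / 2) ^ 2 + ((ρ : ℂ).im - t) ^ 2) := by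
  rw [reZeroSideSum_def, ← tsum_mul_left]
  refine tsum_congr fun ρ ↦ ?_
  rw [re_inv_sub_zero_of_RH hRH]
  ring

/-- `F(s) ≥ 0` under RH for `σ ≥ ½`... in fact for `σ > ½`. [folklore] -/
theorem reZeroSideSum_nonneg_of_RH (hRH : RiemannHypothesis) {σ : ℝ} (hσ : 1 / 2 < σ) (t : ℝ) :
    0 ≤ reZeroSideSum ((σ : ℂ) + t * I) := by
  rw [reZeroSideSum_eq_of_RH hRH]
  exact mul_nonneg (by linarith) (tsum_nonneg fun ρ ↦ div_nonneg (zeroOrder_nonneg ρ) (by positivity))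

/-! ## Summability of `m(ρ) Λ_ρ`, `Λ_ρ = log‖s'−ρ‖ − log‖s−ρ‖` -/

/-- `0 ≤ log‖s'−ρ‖ − log‖s−ρ‖ ≤ (9/8)/((σ−½)² + (γ−t)²)` under RH (`½ < σ ≤ 2`). [folklore] -/
theorem log_norm_sub_bounds_of_RH (hRH : RiemannHypothesis) (ρ : 𝒵) {σ : ℝ} (hσ : 1 / 2 < σ) (hσ2 : σ ≤ 2)
    (t : ℝ) :
    0 ≤ Real.log ‖((2 : ℂ) + t * I) - ρ‖ - Real.log ‖((σ : ℂ) + t * I) - ρ‖ ∧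
      Real.log ‖((2 : ℂ) + t * I) - ρ‖ - Real.log ‖((σ : ℂ) + t * I) - ρ‖ ≤
        (9 / 8) / ((σ - 1 / 2) ^ 2 + ((ρ : ℂ).im - t) ^ 2) := by
  set D : ℝ := (σ - 1 / 2) ^ 2 + ((ρ : ℂ).im - t) ^ 2 with hD
  set D' : ℝ := (2 - 1 / 2) ^ 2 + ((ρ : ℂ).im - t) ^ 2 with hD'
  have hD0 : 0 < D := by positivity
  have hD'0 : 0 < D' := by positivity
  have h1 : ‖((σ : ℂ) + t * I) - ρ‖ ^ 2 = D := norm_sq_sub_zero_of_RH hRH ρ σ t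
  have h2 : ‖((2 : ℂ) + t * I) - ρ‖ ^ 2 = D' := by
    have := norm_sq_sub_zero_of_RH hRH ρ 2 t
    push_cast at this
    exact this
  have hl1 : Real.log ‖((σ : ℂ) + t * I) - ρ‖ = Real.log D / 2 := by
    rw [← h1, Real.log_pow]; push_cast; ring
  have hl2 : Real.log ‖((2 : ℂ) + t * I) - ρ‖ = Real.log D' / 2 := by
    rw [← h2, Real.log_pow]; push_cast; ring
  rw [hl1, hl2]
  have hDD' : D ≤ D' := by rw [hD, hD']; nlinarith
  have hlog : Real.log D ≤ Real.log D' := Real.log_le_log hD0 hDD'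
  refine ⟨by linarith, ?_⟩
  -- `log D' − log D = log(D'/D) ≤ D'/D − 1 = (9/4 − (σ−½)²)/D ≤ (9/4)/D`
  have h3 : Real.log D' - Real.log D ≤ D' / D - 1 := by
    rw [← Real.log_div hD'0.ne' hD0.ne']
    exact Real.log_le_sub_one_of_pos (by positivity)
  have h4 : D' / D - 1 ≤ (9 / 4) / D := by
    rw [div_sub_one hD0.ne', div_le_div_iff_of_pos_right hD0, hD, hD']
    nlinarith
  have : (9 / 4 : ℝ) / D / 2 = 9 / 8 / D := by ring
  linarith

/-- **`Σ_ρ m(ρ)(log‖s'−ρ‖ − log‖s−ρ‖) < ∞`** under RH (`½ < σ ≤ 2`). [folklore] -/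
theorem summable_zeroOrder_mul_log_norm_sub (hRH : RiemannHypothesis) {σ : ℝ} (hσ : 1 / 2 < σ) (hσ2 : σ ≤ 2)
    (t : ℝ) :
    Summable fun ρ : 𝒵 ↦ (riemannZetaZeroOrder (ρ : ℂ) : ℝ) *
      (Real.log ‖((2 : ℂ) + t * I) - ρ‖ - Real.log ‖((σ : ℂ) + t * I) - ρ‖) := by
  have hS := (summable_zeroOrder_div_dist_sq hσ t).mul_left (9 / 8)
  refine Summable.of_nonneg_of_le (fun ρ ↦ ?_) (fun ρ ↦ ?_) hS
  · exact mul_nonneg (zeroOrder_nonneg ρ) (log_norm_sub_bounds_of_RH hRH ρ hσ hσ2 t).1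
  · have h := (log_norm_sub_bounds_of_RH hRH ρ hσ hσ2 t).2
    have hm : 0 ≤ (riemannZetaZeroOrder (ρ : ℂ) : ℝ) := zeroOrder_nonneg ρ
    calc (riemannZetaZeroOrder (ρ : ℂ) : ℝ) * (Real.log ‖((2 : ℂ) + t * I) - ρ‖ - Real.log ‖((σ : ℂ) + t * I) - ρ‖)
        ≤ (riemannZetaZeroOrder (ρ : ℂ) : ℝ) * ((9 / 8) / ((σ - 1 / 2) ^ 2 + ((ρ : ℂ).im - t) ^ 2)) :=
          mul_le_mul_of_nonneg_left h hm
      _ = 9 / 8 * ((riemannZetaZeroOrder (ρ : ℂ) : ℝ) / ((σ - 1 / 2) ^ 2 + ((ρ : ℂ).im - t) ^ 2)) := by ring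

/-! ## The paired Mellin transform at a zero -/

/-- `ĝ_u(ρ) = Ψ(ρ − z_u) + Ψ(1 − ρ − z_u)` for `g_u = test ((u−½)+it) L`, `z_u = u + it`. [folklore] -/
theorem weilMellin_test_zero_eq {L : ℝ} (hL : 0 ≤ L) (u t : ℝ) (ρ : ℂ) :
    weilMellin (test (((u - 1 / 2 : ℝ) : ℂ) + t * I) L) ρ =
      psiInt L (ρ - ((u : ℂ) + t * I)) + psiInt L (1 - ρ - ((u : ℂ) + t * I)) := by
  rw [weilMellin_test _ hL]
  congr 2 <;> (push_cast; ring)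

/-- `1/(xy) ≤ (1/x² + 1/y²)/2` for `x, y > 0`. [folklore] -/
theorem inv_mul_le_half {x y : ℝ} (hx : 0 < x) (hy : 0 < y) : 1 / (x * y) ≤ (1 / x ^ 2 + 1 / y ^ 2) / 2 := by
  rw [div_add_div _ _ (by positivity) (by positivity), div_div, div_le_div_iff₀ (by positivity) (by positivity)]
  nlinarith [sq_nonneg (x - y), mul_pos hx hy]

/-- **Uniform bound for the zero terms** (RH, `½ < σ ≤ u ≤ 2`, `L ≥ 0`):
`‖ĝ_u(ρ)‖ ≤ (2 + L(5 + 2|t|)/2) · (1/((σ−½)²+(γ−t)²) + 1/((σ−½)²+(γ+t)²))`. [cite: BalazardDeRoton2008, Prop. 5 (proof)] -/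
theorem norm_weilMellin_test_zero_le (hRH : RiemannHypothesis) (ρ : 𝒵) {σ u t L : ℝ} (hσ : 1 / 2 < σ)
    (hu : σ ≤ u) (hu2 : u ≤ 2) (hL : 0 ≤ L) :
    ‖weilMellin (test (((u - 1 / 2 : ℝ) : ℂ) + t * I) L) ρ‖ ≤
      (2 + L * (5 + 2 * |t|) / 2) *
        (1 / ((σ - 1 / 2) ^ 2 + ((ρ : ℂ).im - t) ^ 2) + 1 / ((σ - 1 / 2) ^ 2 + ((ρ : ℂ).im + t) ^ 2)) := by
  rw [weilMellin_test_zero_eq hL]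
  set a : ℂ := (ρ : ℂ) - ((u : ℂ) + t * I) with ha
  set b : ℂ := 1 - (ρ : ℂ) - ((u : ℂ) + t * I) with hb
  have hρre := re_eq_half_of_RH hRH ρ
  have hare : a.re = 1 / 2 - u := by simp [ha, hρre]
  have hbre : b.re = 1 / 2 - u := by simp [hb, hρre]; ring
  have haim : a.im = (ρ : ℂ).im - t := by simp [ha]
  have hbim : b.im = -((ρ : ℂ).im + t) := by simp [hb]; ring
  have hare' : a.re ≤ 0 := by rw [hare]; linarith
  have hbre' : b.re ≤ 0 := by rw [hbre]; linarith
  set D₁ : ℝ := (σ - 1 / 2) ^ 2 + ((ρ : ℂ).im - t) ^ 2 with hD₁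
  set D₂ : ℝ := (σ - 1 / 2) ^ 2 + ((ρ : ℂ).im + t) ^ 2 with hD₂
  have hσ' : 0 < σ - 1 / 2 := by linarith
  have hD₁0 : 0 < D₁ := by positivity
  have hD₂0 : 0 < D₂ := by positivity
  have ha2 : D₁ ≤ ‖a‖ ^ 2 := by
    rw [Complex.sq_norm, Complex.normSq_apply, hare, haim, hD₁]; nlinarith
  have hb2 : D₂ ≤ ‖b‖ ^ 2 := by
    rw [Complex.sq_norm, Complex.normSq_apply, hbre, hbim, hD₂]; nlinarith
  have ha0' : 0 < ‖a‖ := by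
    by_contra h
    have : ‖a‖ = 0 := le_antisymm (not_lt.1 h) (norm_nonneg a)
    rw [this] at ha2; norm_num at ha2; linarith
  have hb0' : 0 < ‖b‖ := by
    by_contra h
    have : ‖b‖ = 0 := le_antisymm (not_lt.1 h) (norm_nonneg b)
    rw [this] at hb2; norm_num at hb2; linarith
  have ha0 : a ≠ 0 := norm_pos_iff.1 ha0'
  have hb0 : b ≠ 0 := norm_pos_iff.1 hb0'
  rw [psiInt_add_psiInt ha0 hb0]
  obtain ⟨hE₁, hE₂⟩ := norm_pieces_le (a := a) (b := b) hare' hbre' hL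
  have hab : a + b = 1 - 2 * ((u : ℂ) + t * I) := by rw [ha, hb]; ring
  have hnab : ‖a + b‖ ≤ 5 + 2 * |t| := by
    rw [hab]
    calc ‖(1 : ℂ) - 2 * ((u : ℂ) + t * I)‖ ≤ ‖(1 : ℂ)‖ + ‖2 * ((u : ℂ) + t * I)‖ := norm_sub_le _ _
      _ ≤ 1 + 2 * (‖(u : ℂ)‖ + ‖(t : ℂ) * I‖) := by
          rw [norm_one, norm_mul, Complex.norm_ofNat]; gcongr; exact norm_add_le _ _
      _ = 1 + 2 * (|u| + |t|) := by simp
      _ ≤ 5 + 2 * |t| := by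
          have : |u| ≤ 2 := abs_le.2 ⟨by linarith, hu2⟩
          linarith
  have h3 : ‖(L : ℂ) * (a + b) / (a * b)‖ ≤ L * (5 + 2 * |t|) * ((1 / ‖a‖ ^ 2 + 1 / ‖b‖ ^ 2) / 2) := by
    rw [norm_div, norm_mul, norm_mul, Complex.norm_real, Real.norm_eq_abs, abs_of_nonneg hL, div_eq_mul_one_div]
    refine mul_le_mul (mul_le_mul_of_nonneg_left hnab hL) (inv_mul_le_half ha0' hb0') (by positivity) (by positivity)
  have hinv1 : 1 / ‖a‖ ^ 2 ≤ 1 / D₁ := one_div_le_one_div_of_le hD₁0 ha2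
  have hinv2 : 1 / ‖b‖ ^ 2 ≤ 1 / D₂ := one_div_le_one_div_of_le hD₂0 hb2
  have hsum_inv : 1 / ‖a‖ ^ 2 + 1 / ‖b‖ ^ 2 ≤ 1 / D₁ + 1 / D₂ := add_le_add hinv1 hinv2
  calc ‖Complex.exp (a * L) / a ^ 2 + Complex.exp (b * L) / b ^ 2 - (1 / a ^ 2 + 1 / b ^ 2) -
        (L : ℂ) * (a + b) / (a * b)‖
      ≤ ‖Complex.exp (a * L) / a ^ 2 + Complex.exp (b * L) / b ^ 2‖ + ‖(1 / a ^ 2 + 1 / b ^ 2 : ℂ)‖ +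
          ‖(L : ℂ) * (a + b) / (a * b)‖ := by
        have e1 := norm_sub_le (Complex.exp (a * L) / a ^ 2 + Complex.exp (b * L) / b ^ 2 - (1 / a ^ 2 + 1 / b ^ 2))
          ((L : ℂ) * (a + b) / (a * b))
        have e2 := norm_sub_le (Complex.exp (a * L) / a ^ 2 + Complex.exp (b * L) / b ^ 2) (1 / a ^ 2 + 1 / b ^ 2 : ℂ)
        linarith
    _ ≤ (1 / ‖a‖ ^ 2 + 1 / ‖b‖ ^ 2) + (1 / ‖a‖ ^ 2 + 1 / ‖b‖ ^ 2) +
          L * (5 + 2 * |t|) * ((1 / ‖a‖ ^ 2 + 1 / ‖b‖ ^ 2) / 2) := by linarith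
    _ = (2 + L * (5 + 2 * |t|) / 2) * (1 / ‖a‖ ^ 2 + 1 / ‖b‖ ^ 2) := by ring
    _ ≤ (2 + L * (5 + 2 * |t|) / 2) * (1 / D₁ + 1 / D₂) := by
        refine mul_le_mul_of_nonneg_left hsum_inv (by positivity)

/-- The summable majorant of the zero terms: `m(ρ)(1/((σ−½)²+(γ−t)²) + 1/((σ−½)²+(γ+t)²))`. [folklore] -/
theorem summable_zeroOrder_mul_two_inv {σ : ℝ} (hσ : 1 / 2 < σ) (t : ℝ) :
    Summable fun ρ : 𝒵 ↦ (riemannZetaZeroOrder (ρ : ℂ) : ℝ) *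
      (1 / ((σ - 1 / 2) ^ 2 + ((ρ : ℂ).im - t) ^ 2) + 1 / ((σ - 1 / 2) ^ 2 + ((ρ : ℂ).im + t) ^ 2)) := by
  have h1 := summable_zeroOrder_div_dist_sq hσ t
  have h2 := summable_zeroOrder_div_dist_sq hσ (-t)
  refine (h1.add h2).congr fun ρ ↦ ?_
  simp only [sub_neg_eq_add]
  ring

/-- **The zero side converges absolutely** (hypothesis `hZ` of `explicit_formula_continuous`) for
`g_u`, `½ < σ ≤ u ≤ 2`, under RH. [folklore] -/
theorem summable_norm_zeroSide_test (hRH : RiemannHypothesis) {σ u t L : ℝ} (hσ : 1 / 2 < σ) (hu : σ ≤ u)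
    (hu2 : u ≤ 2) (hL : 0 ≤ L) :
    Summable fun ρ : 𝒵 ↦ ‖(riemannZetaZeroOrder (ρ : ℂ) : ℂ) *
      weilMellin (test (((u - 1 / 2 : ℝ) : ℂ) + t * I) L) ρ‖ := by
  have hS := (summable_zeroOrder_mul_two_inv hσ t).mul_left (2 + L * (5 + 2 * |t|) / 2)
  refine Summable.of_nonneg_of_le (fun ρ ↦ norm_nonneg _) (fun ρ ↦ ?_) hS
  rw [norm_mul, Complex.norm_intCast]
  have hm : (0 : ℝ) ≤ (riemannZetaZeroOrder (ρ : ℂ) : ℝ) := zeroOrder_nonneg ρ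
  have habs : |((riemannZetaZeroOrder (ρ : ℂ) : ℤ) : ℝ)| = (riemannZetaZeroOrder (ρ : ℂ) : ℝ) := abs_of_nonneg hm
  rw [habs]
  have h := norm_weilMellin_test_zero_le hRH ρ hσ hu hu2 hL (t := t)
  calc (riemannZetaZeroOrder (ρ : ℂ) : ℝ) * ‖weilMellin (test (((u - 1 / 2 : ℝ) : ℂ) + t * I) L) ρ‖
      ≤ (riemannZetaZeroOrder (ρ : ℂ) : ℝ) * ((2 + L * (5 + 2 * |t|) / 2) *
          (1 / ((σ - 1 / 2) ^ 2 + ((ρ : ℂ).im - t) ^ 2) + 1 / ((σ - 1 / 2) ^ 2 + ((ρ : ℂ).im + t) ^ 2))) :=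
        mul_le_mul_of_nonneg_left h hm
    _ = _ := by ring

/-- **The explicit formula for `g_u`** (RH, `½ < σ ≤ u ≤ 2`, `L ≥ 0`):
`Σ_ρ m(ρ) ĝ_u(ρ) = ĝ_u(0) + ĝ_u(1) − P(g_u) + W_∞(g_u)`. [cite: BalazardDeRoton2008, Prop. 3 / (t55) via Weil] -/
theorem explicit_formula_test (hRH : RiemannHypothesis) {σ u t L : ℝ} (hσ : 1 / 2 < σ) (hu : σ ≤ u)
    (hu2 : u ≤ 2) (hL : 0 ≤ L) :
    ∑' ρ : 𝒵, (riemannZetaZeroOrder (ρ : ℂ) : ℂ) * weilMellin (test (((u - 1 / 2 : ℝ) : ℂ) + t * I) L) ρ =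
      weilFunctional (test (((u - 1 / 2 : ℝ) : ℂ) + t * I) L) := by
  set c : ℂ := ((u - 1 / 2 : ℝ) : ℂ) + t * I with hc
  have hcre : 0 ≤ c.re := by simp [hc]; linarith
  have hZ := summable_norm_zeroSide_test hRH hσ hu hu2 hL (t := t)
  have hA := integrable_weilMellin_test_mul_reDigamma hcre hL
  have h1 := explicit_formula_continuous (continuous_test c L) (hasCompactSupport_test c L) hZ hA
  exact tendsto_nhds_unique (hasWeilZeroSide_tsum hZ) h1

/-! ## Continuity in `u` and termwise integration over `[σ, 2]` -/

section Interchange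

open intervalIntegral

/-- `u ↦ Ψ_L(w − (u+it))` is continuous on `[σ, 2]` when `Re w < σ` (closed form). [folklore] -/
theorem continuousOn_psiInt_sub_line {w : ℂ} {σ : ℝ} (hw : w.re < σ) (t L : ℝ) :
    ContinuousOn (fun u : ℝ ↦ psiInt L (w - ((u : ℂ) + t * I))) (Icc σ 2) := by
  have hne : ∀ u ∈ Icc σ 2, w - ((u : ℂ) + t * I) ≠ 0 := fun u hu ↦ sub_line_ne_zero (t := t) hw hu.1
  have hc : ContinuousOn (fun u : ℝ ↦ (Complex.exp ((w - ((u : ℂ) + t * I)) * L) - 1 - (w - ((u : ℂ) + t * I)) * L) /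
      (w - ((u : ℂ) + t * I)) ^ 2) (Icc σ 2) :=
    ContinuousOn.div (by fun_prop) (by fun_prop) fun u hu ↦ pow_ne_zero 2 (hne u hu)
  exact hc.congr fun u hu ↦ psiInt_eq (hne u hu)

/-- `u ↦ ĝ_u(ρ)` is continuous on `[σ, 2]` (RH, `σ > ½`). [folklore] -/
theorem continuousOn_weilMellin_test_zero (hRH : RiemannHypothesis) (ρ : 𝒵) {σ : ℝ} (hσ : 1 / 2 < σ)
    (t : ℝ) {L : ℝ} (hL : 0 ≤ L) :
    ContinuousOn (fun u : ℝ ↦ weilMellin (test (((u - 1 / 2 : ℝ) : ℂ) + t * I) L) ρ) (Icc σ 2) := by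
  have hρ : (ρ : ℂ).re < σ := by rw [re_eq_half_of_RH hRH ρ]; exact hσ
  have hρ' : (1 - (ρ : ℂ)).re < σ := by simp [re_eq_half_of_RH hRH ρ]; linarith
  have h1 := continuousOn_psiInt_sub_line hρ t L
  have h2 := continuousOn_psiInt_sub_line hρ' t L
  refine (h1.add h2).congr fun u _ ↦ ?_
  rw [weilMellin_test_zero_eq hL]
  rfl

/-- **The zero side `u ↦ Σ_ρ m(ρ) ĝ_u(ρ)` is continuous on `[σ, 2]`** (uniform convergence). [folklore] -/
theorem continuousOn_zeroSide_test (hRH : RiemannHypothesis) {σ : ℝ} (hσ : 1 / 2 < σ) (t : ℝ) {L : ℝ}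
    (hL : 0 ≤ L) :
    ContinuousOn (fun u : ℝ ↦ ∑' ρ : 𝒵, (riemannZetaZeroOrder (ρ : ℂ) : ℂ) *
      weilMellin (test (((u - 1 / 2 : ℝ) : ℂ) + t * I) L) ρ) (Icc σ 2) := by
  have hS := (summable_zeroOrder_mul_two_inv hσ t).mul_left (2 + L * (5 + 2 * |t|) / 2)
  refine continuousOn_tsum (fun ρ ↦ (continuousOn_const.mul (continuousOn_weilMellin_test_zero hRH ρ hσ t hL)))
    hS fun ρ u hu ↦ ?_
  rw [norm_mul, Complex.norm_intCast, abs_of_nonneg (zeroOrder_nonneg ρ)]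
  have h := norm_weilMellin_test_zero_le hRH ρ hσ hu.1 hu.2 hL (t := t)
  calc (riemannZetaZeroOrder (ρ : ℂ) : ℝ) * ‖weilMellin (test (((u - 1 / 2 : ℝ) : ℂ) + t * I) L) ρ‖
      ≤ (riemannZetaZeroOrder (ρ : ℂ) : ℝ) * ((2 + L * (5 + 2 * |t|) / 2) *
          (1 / ((σ - 1 / 2) ^ 2 + ((ρ : ℂ).im - t) ^ 2) + 1 / ((σ - 1 / 2) ^ 2 + ((ρ : ℂ).im + t) ^ 2))) :=
        mul_le_mul_of_nonneg_left h (zeroOrder_nonneg ρ)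
    _ = _ := by ring

/-- **Termwise integration of the zero side over `u ∈ [σ, 2]`** (RH, `½ < σ ≤ 2`, `L ≥ 0`):
`∫_σ^2 Re Σ_ρ m(ρ) ĝ_u(ρ) du = Σ_ρ m(ρ) ∫_σ^2 Re ĝ_u(ρ) du`. [folklore] -/
theorem integral_re_zeroSide_test (hRH : RiemannHypothesis) {σ : ℝ} (hσ : 1 / 2 < σ) (hσ2 : σ ≤ 2) (t : ℝ)
    {L : ℝ} (hL : 0 ≤ L) :
    ∫ u in σ..2, (∑' ρ : 𝒵, (riemannZetaZeroOrder (ρ : ℂ) : ℂ) *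
        weilMellin (test (((u - 1 / 2 : ℝ) : ℂ) + t * I) L) ρ).re =
      ∑' ρ : 𝒵, (riemannZetaZeroOrder (ρ : ℂ) : ℝ) *
        ∫ u in σ..2, (weilMellin (test (((u - 1 / 2 : ℝ) : ℂ) + t * I) L) ρ).re := by
  set B : 𝒵 → ℝ := fun ρ ↦ (2 + L * (5 + 2 * |t|) / 2) * ((riemannZetaZeroOrder (ρ : ℂ) : ℝ) *
    (1 / ((σ - 1 / 2) ^ 2 + ((ρ : ℂ).im - t) ^ 2) + 1 / ((σ - 1 / 2) ^ 2 + ((ρ : ℂ).im + t) ^ 2))) with hB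
  have hBsum : Summable B := (summable_zeroOrder_mul_two_inv hσ t).mul_left _
  set F : 𝒵 → ℝ → ℝ := fun ρ u ↦ (riemannZetaZeroOrder (ρ : ℂ) : ℝ) *
    (weilMellin (test (((u - 1 / 2 : ℝ) : ℂ) + t * I) L) ρ).re with hF
  -- pointwise: real part of the sum is the sum of the `F ρ u`
  have hpt : ∀ u ∈ Icc σ 2, (∑' ρ : 𝒵, (riemannZetaZeroOrder (ρ : ℂ) : ℂ) *
      weilMellin (test (((u - 1 / 2 : ℝ) : ℂ) + t * I) L) ρ).re = ∑' ρ : 𝒵, F ρ u := by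
    intro u hu
    have hZ := summable_norm_zeroSide_test hRH hσ hu.1 hu.2 hL (t := t)
    rw [Complex.re_tsum (Summable.of_norm hZ)]
    refine tsum_congr fun ρ ↦ ?_
    simp [hF, Complex.mul_re]
  -- bounds for `F ρ` on `[σ, 2]`
  have hFle : ∀ ρ : 𝒵, ∀ u ∈ Icc σ 2, ‖F ρ u‖ ≤ B ρ := by
    intro ρ u hu
    rw [hF, hB]
    dsimp only
    rw [norm_mul, Real.norm_eq_abs, abs_of_nonneg (zeroOrder_nonneg ρ), Real.norm_eq_abs]
    have h := (Complex.abs_re_le_norm _).trans (norm_weilMellin_test_zero_le hRH ρ hσ hu.1 hu.2 hL (t := t))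
    have := mul_le_mul_of_nonneg_left h (zeroOrder_nonneg ρ)
    linarith [this]
  have hFcont : ∀ ρ : 𝒵, ContinuousOn (F ρ) (Icc σ 2) := fun ρ ↦
    continuousOn_const.mul (Complex.continuous_re.comp_continuousOn (continuousOn_weilMellin_test_zero hRH ρ hσ t hL))
  have hFint : ∀ ρ : 𝒵, IntegrableOn (F ρ) (Ioc σ 2) := fun ρ ↦
    ((hFcont ρ).integrableOn_Icc).mono_set Ioc_subset_Icc_self
  -- summability of `∫ ‖F ρ‖`
  have hnorm : ∀ ρ : 𝒵, ∫ u in Ioc σ 2, ‖F ρ u‖ ≤ B ρ * (2 - σ) := by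
    intro ρ
    calc ∫ u in Ioc σ 2, ‖F ρ u‖ ≤ ∫ _ in Ioc σ 2, B ρ :=
          setIntegral_mono_on (hFint ρ).norm (integrableOn_const (by simp [Real.volume_Ioc])) measurableSet_Ioc
            fun u hu ↦ hFle ρ u (Ioc_subset_Icc_self hu)
      _ = B ρ * (2 - σ) := by
          rw [setIntegral_const, Real.volume_real_Ioc, max_eq_left (by linarith), smul_eq_mul, mul_comm]
  have hsum : Summable fun ρ : 𝒵 ↦ ∫ u in Ioc σ 2, ‖F ρ u‖ :=
    Summable.of_nonneg_of_le (fun ρ ↦ integral_nonneg fun u ↦ norm_nonneg _) hnorm (hBsum.mul_right _)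
  have hmain := integral_tsum_of_summable_integral_norm (μ := volume.restrict (Ioc σ 2)) hFint hsum
  -- rewrite interval integrals as set integrals
  rw [intervalIntegral.integral_of_le hσ2]
  have e1 : ∫ u in Ioc σ 2, (∑' ρ : 𝒵, (riemannZetaZeroOrder (ρ : ℂ) : ℂ) *
      weilMellin (test (((u - 1 / 2 : ℝ) : ℂ) + t * I) L) ρ).re = ∫ u in Ioc σ 2, ∑' ρ : 𝒵, F ρ u :=
    setIntegral_congr_fun measurableSet_Ioc fun u hu ↦ hpt u (Ioc_subset_Icc_self hu)
  rw [e1, ← hmain]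
  refine tsum_congr fun ρ ↦ ?_
  rw [intervalIntegral.integral_of_le hσ2]
  simp only [hF]
  exact (MeasureTheory.integral_const_mul (μ := volume.restrict (Ioc σ 2)) ((riemannZetaZeroOrder (ρ : ℂ) : ℝ))
    (fun u : ℝ ↦ (weilMellin (test (((u - 1 / 2 : ℝ) : ℂ) + t * I) L) ρ).re))

/-- **`∫_σ^2 Re ĝ_u(ρ) du`, explicitly** (RH, `½ < σ ≤ 2`, `L > 0`): with `s = σ+it`, `s' = 2+it`,
`ρ' = 1 − ρ`, it equals
`E_ρ + [Re 1/(s'−ρ) − Re 1/(s−ρ) + Re 1/(s'−ρ') − Re 1/(s−ρ')] + L[Λ_ρ + Λ_{ρ'}]`,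
`|E_ρ| ≤ x^{½−σ}(1/‖s−ρ‖² + 1/‖s−ρ'‖²)/L`. [cite: BalazardDeRoton2008, Prop. 5 (proof)] -/
theorem integral_re_weilMellin_test_zero (hRH : RiemannHypothesis) (ρ : 𝒵) {σ : ℝ} (hσ : 1 / 2 < σ)
    (hσ2 : σ ≤ 2) (t : ℝ) {L : ℝ} (hL : 0 < L) :
    ∃ E : ℝ, |E| ≤ Real.exp ((1 / 2 - σ) * L) / L *
        (1 / ‖((σ : ℂ) + t * I) - ρ‖ ^ 2 + 1 / ‖((σ : ℂ) + t * I) - (1 - ρ)‖ ^ 2) ∧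
      ∫ u in σ..2, (weilMellin (test (((u - 1 / 2 : ℝ) : ℂ) + t * I) L) ρ).re =
        E + ((1 / (((2 : ℂ) + t * I) - ρ)).re - (1 / (((σ : ℂ) + t * I) - ρ)).re +
              ((1 / (((2 : ℂ) + t * I) - (1 - ρ))).re - (1 / (((σ : ℂ) + t * I) - (1 - ρ))).re)) +
          L * ((Real.log ‖((2 : ℂ) + t * I) - ρ‖ - Real.log ‖((σ : ℂ) + t * I) - ρ‖) +
            (Real.log ‖((2 : ℂ) + t * I) - (1 - ρ)‖ - Real.log ‖((σ : ℂ) + t * I) - (1 - ρ)‖)) := by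
  have hρ : (ρ : ℂ).re = 1 / 2 := re_eq_half_of_RH hRH ρ
  have hρ' : (1 - (ρ : ℂ)).re = 1 / 2 := by simp [hρ]; norm_num
  obtain ⟨E₁, hE₁, h₁⟩ := integral_re_psiInt_sub_line (t := t) hρ hσ hσ2 hL
  obtain ⟨E₂, hE₂, h₂⟩ := integral_re_psiInt_sub_line (t := t) hρ' hσ hσ2 hL
  refine ⟨E₁ + E₂, ?_, ?_⟩
  · refine (abs_add_le _ _).trans ?_
    rw [mul_add]
    refine add_le_add (hE₁.trans (le_of_eq ?_)) (hE₂.trans (le_of_eq ?_)) <;> ring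
  have hc1 := continuousOn_psiInt_sub_line (t := t) (L := L) (by rw [hρ]; exact hσ : (ρ : ℂ).re < σ)
  have hc2 := continuousOn_psiInt_sub_line (t := t) (L := L) (by rw [hρ']; exact hσ : (1 - (ρ : ℂ)).re < σ)
  have hi1 : IntervalIntegrable (fun u : ℝ ↦ (psiInt L ((ρ : ℂ) - ((u : ℂ) + t * I))).re) volume σ 2 := by
    refine (Complex.continuous_re.comp_continuousOn hc1).intervalIntegrable_of_Icc hσ2
  have hi2 : IntervalIntegrable (fun u : ℝ ↦ (psiInt L (1 - (ρ : ℂ) - ((u : ℂ) + t * I))).re) volume σ 2 := by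
    refine (Complex.continuous_re.comp_continuousOn hc2).intervalIntegrable_of_Icc hσ2
  have e : ∀ u : ℝ, (weilMellin (test (((u - 1 / 2 : ℝ) : ℂ) + t * I) L) ρ).re =
      (psiInt L ((ρ : ℂ) - ((u : ℂ) + t * I))).re + (psiInt L (1 - (ρ : ℂ) - ((u : ℂ) + t * I))).re := by
    intro u; rw [weilMellin_test_zero_eq hL.le, Complex.add_re]
  simp_rw [e]
  rw [intervalIntegral.integral_add hi1 hi2, h₁, h₂]
  ring

/-! ## `∫_σ^2 F(u+it) du = Σ_ρ m(ρ) Λ_ρ` -/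

/-- The terms of `F(u + it)` on `[σ,2]` under RH: `m(ρ) Re 1/((u+it) − ρ) = m(ρ)(u−½)/((u−½)²+(γ−t)²)`,
bounded by `m(ρ)(3/2)/((σ−½)²+(γ−t)²)`. [folklore] -/
theorem zeroSideSum_term_le (hRH : RiemannHypothesis) (ρ : 𝒵) {σ : ℝ} (hσ : 1 / 2 < σ) {u : ℝ}
    (hu : u ∈ Icc σ 2) (t : ℝ) :
    ‖(riemannZetaZeroOrder (ρ : ℂ) : ℝ) * (1 / (((u : ℂ) + t * I) - ρ)).re‖ ≤
      (3 / 2) * ((riemannZetaZeroOrder (ρ : ℂ) : ℝ) / ((σ - 1 / 2) ^ 2 + ((ρ : ℂ).im - t) ^ 2)) := by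
  rw [re_inv_sub_zero_of_RH hRH, norm_mul, Real.norm_eq_abs, abs_of_nonneg (zeroOrder_nonneg ρ), Real.norm_eq_abs,
    abs_of_nonneg (div_nonneg (by linarith [hu.1]) (by positivity))]
  have hσ' : 0 < σ - 1 / 2 := by linarith
  have hD : (σ - 1 / 2) ^ 2 + ((ρ : ℂ).im - t) ^ 2 ≤ (u - 1 / 2) ^ 2 + ((ρ : ℂ).im - t) ^ 2 := by
    nlinarith [hu.1]
  have hD0 : 0 < (σ - 1 / 2) ^ 2 + ((ρ : ℂ).im - t) ^ 2 := by positivity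
  have h1 : (u - 1 / 2) / ((u - 1 / 2) ^ 2 + ((ρ : ℂ).im - t) ^ 2) ≤ (3 / 2) / ((σ - 1 / 2) ^ 2 + ((ρ : ℂ).im - t) ^ 2) := by
    calc (u - 1 / 2) / ((u - 1 / 2) ^ 2 + ((ρ : ℂ).im - t) ^ 2)
        ≤ (u - 1 / 2) / ((σ - 1 / 2) ^ 2 + ((ρ : ℂ).im - t) ^ 2) :=
          div_le_div_of_nonneg_left (by linarith [hu.1]) hD0 hD
      _ ≤ (3 / 2) / ((σ - 1 / 2) ^ 2 + ((ρ : ℂ).im - t) ^ 2) := by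
          gcongr; linarith [hu.2]
  have := mul_le_mul_of_nonneg_left h1 (zeroOrder_nonneg ρ)
  calc (riemannZetaZeroOrder (ρ : ℂ) : ℝ) * ((u - 1 / 2) / ((u - 1 / 2) ^ 2 + ((ρ : ℂ).im - t) ^ 2))
      ≤ (riemannZetaZeroOrder (ρ : ℂ) : ℝ) * ((3 / 2) / ((σ - 1 / 2) ^ 2 + ((ρ : ℂ).im - t) ^ 2)) := this
    _ = _ := by ring

/-- **`u ↦ F(u+it)` is continuous on `[σ, 2]`** (RH, `σ > ½`). [folklore] -/
theorem continuousOn_reZeroSideSum (hRH : RiemannHypothesis) {σ : ℝ} (hσ : 1 / 2 < σ) (t : ℝ) :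
    ContinuousOn (fun u : ℝ ↦ reZeroSideSum ((u : ℂ) + t * I)) (Icc σ 2) := by
  have hS := (summable_zeroOrder_div_dist_sq hσ t).mul_left (3 / 2)
  simp_rw [reZeroSideSum_def]
  refine continuousOn_tsum (fun ρ ↦ ?_) hS fun ρ u hu ↦ zeroSideSum_term_le hRH ρ hσ hu t
  refine continuousOn_const.mul (Complex.continuous_re.comp_continuousOn ?_)
  refine ContinuousOn.div continuousOn_const (by fun_prop) fun u hu ↦ ?_
  have hρ : (ρ : ℂ).re < σ := by rw [re_eq_half_of_RH hRH ρ]; exact hσ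
  intro h
  have := sub_line_ne_zero (t := t) hρ hu.1
  rw [← neg_sub, neg_eq_zero] at h
  exact this h

/-- **`∫_σ^2 F(u + it) du = Σ_ρ m(ρ)(log‖s'−ρ‖ − log‖s−ρ‖)`** (RH, `½ < σ ≤ 2`; Tonelli for the
non-negative terms `m(ρ)(u−½)/‖(u+it)−ρ‖²`). [cite: BalazardDeRoton2008, Prop. 5 (proof)] -/
theorem integral_reZeroSideSum (hRH : RiemannHypothesis) {σ : ℝ} (hσ : 1 / 2 < σ) (hσ2 : σ ≤ 2) (t : ℝ) :
    ∫ u in σ..2, reZeroSideSum ((u : ℂ) + t * I) =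
      ∑' ρ : 𝒵, (riemannZetaZeroOrder (ρ : ℂ) : ℝ) *
        (Real.log ‖((2 : ℂ) + t * I) - ρ‖ - Real.log ‖((σ : ℂ) + t * I) - ρ‖) := by
  set F : 𝒵 → ℝ → ℝ := fun ρ u ↦ (riemannZetaZeroOrder (ρ : ℂ) : ℝ) * (1 / (((u : ℂ) + t * I) - ρ)).re with hF
  set B : 𝒵 → ℝ := fun ρ ↦ (3 / 2) * ((riemannZetaZeroOrder (ρ : ℂ) : ℝ) / ((σ - 1 / 2) ^ 2 + ((ρ : ℂ).im - t) ^ 2))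
    with hB
  have hBsum : Summable B := (summable_zeroOrder_div_dist_sq hσ t).mul_left _
  have hFcont : ∀ ρ : 𝒵, ContinuousOn (F ρ) (Icc σ 2) := by
    intro ρ
    refine continuousOn_const.mul (Complex.continuous_re.comp_continuousOn ?_)
    refine ContinuousOn.div continuousOn_const (by fun_prop) fun u hu ↦ ?_
    have hρ : (ρ : ℂ).re < σ := by rw [re_eq_half_of_RH hRH ρ]; exact hσ
    intro h
    have := sub_line_ne_zero (t := t) hρ hu.1
    rw [← neg_sub, neg_eq_zero] at h
    exact this h
  have hFint : ∀ ρ : 𝒵, IntegrableOn (F ρ) (Ioc σ 2) := fun ρ ↦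
    ((hFcont ρ).integrableOn_Icc).mono_set Ioc_subset_Icc_self
  have hnorm : ∀ ρ : 𝒵, ∫ u in Ioc σ 2, ‖F ρ u‖ ≤ B ρ * (2 - σ) := by
    intro ρ
    calc ∫ u in Ioc σ 2, ‖F ρ u‖ ≤ ∫ _ in Ioc σ 2, B ρ :=
          setIntegral_mono_on (hFint ρ).norm (integrableOn_const (by simp [Real.volume_Ioc])) measurableSet_Ioc
            fun u hu ↦ zeroSideSum_term_le hRH ρ hσ (Ioc_subset_Icc_self hu) t
      _ = B ρ * (2 - σ) := by
          rw [setIntegral_const, Real.volume_real_Ioc, max_eq_left (by linarith), smul_eq_mul, mul_comm]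
  have hsum : Summable fun ρ : 𝒵 ↦ ∫ u in Ioc σ 2, ‖F ρ u‖ :=
    Summable.of_nonneg_of_le (fun ρ ↦ integral_nonneg fun u ↦ norm_nonneg _) hnorm (hBsum.mul_right _)
  have hmain := integral_tsum_of_summable_integral_norm (μ := volume.restrict (Ioc σ 2)) hFint hsum
  rw [intervalIntegral.integral_of_le hσ2]
  have e1 : ∫ u in Ioc σ 2, reZeroSideSum ((u : ℂ) + t * I) = ∫ u in Ioc σ 2, ∑' ρ : 𝒵, F ρ u :=
    setIntegral_congr_fun measurableSet_Ioc fun u _ ↦ by rw [reZeroSideSum_def]; rfl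
  rw [e1, ← hmain]
  refine tsum_congr fun ρ ↦ ?_
  -- `∫_σ^2 m Re 1/(z_u − ρ) du = m (log‖s'−ρ‖ − log‖s−ρ‖)`
  have hρ : (ρ : ℂ).re < σ := by rw [re_eq_half_of_RH hRH ρ]; exact hσ
  have h := integral_re_inv_sub_line (t := t) hρ hσ2
  rw [← intervalIntegral.integral_of_le hσ2]
  simp only [hF]
  rw [intervalIntegral.integral_const_mul]
  congr 1
  have e2 : ∀ u : ℝ, (1 / (((u : ℂ) + t * I) - ρ)).re = -(1 / ((ρ : ℂ) - ((u : ℂ) + t * I))).re := fun u ↦ by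
    rw [← neg_sub ((u : ℂ) + t * I) (ρ : ℂ), div_neg_eq_neg_div, Complex.neg_re, neg_neg]
  simp_rw [e2]
  rw [intervalIntegral.integral_neg, h]
  ring

end Interchange

end SoundTest

end Literature.NumberTheory.LFunctions
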